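import Literature.Barriers.Schanuel.EFunctionValuesAtAlgebraicPoints
import HarnessLib

/-!
# `E`-values contain `ℚ̄`; the printed exclusions "`e + π`, `eπ`, `e^e`, `π^e` are not `E`-values" each imply an OPEN transcendence statement

`Literature/Barriers/Schanuel/EFunctionValuesAtAlgebraicPointsProofs.lean` — PROVED companion of
`Literature/Barriers/Schanuel/EFunctionValuesAtAlgebraicPoints.lean` (barrier catalogue entry for
the summit `Schanuel`, the Siegel–Shidlovskii `E`-function method). It records, as theorems, why
the four conjectural named statements `ExpAddPiNotEValue`, `ExpMulPiNotEValue`, `ExpExpNotEValue`,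
`PiPowExpNotEValue` of the parent file have NO `_holds` discharge: each implies the transcendence
of a number whose arithmetic nature is, in print, unknown.

## What the source prints (verified on the page) [Rivoal2024]

* §5.1, p. 228: "Donnons quelques exemples de `E`-fonctions : les polynômes de `ℚ̄[z]`, la fonction
  de Bessel `J₀`, … `sin(z)`, `cos(z)`, …" — in particular every constant `β ∈ ℚ̄` is an
  `E`-function (it satisfies Définition 5.2 trivially), so every algebraic number `β = β(0)` is the
  value of an `E`-function at an algebraic point.
* §5, p. 226: "l'on pense que la constante d'Euler `γ`, `Γ(1/5)`, `ln(π)`, `δ`, `e + π`, `eπ`, `e^e`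
  et `π^e` ne sont des valeurs en un point algébrique ni d'une `E`-fonction ni d'une `G`-fonction"
  — a BELIEF ("on pense que"), rendered in the parent file as the four named statements above.
* §4, p. 204: "On ne sait pas montrer non plus que les nombres `e + π` et `eπ` sont irrationnels,
  bien que l'on sache qu'au moins l'un des deux est transcendant car `e` et `π` le sont. On sait
  que `2^√2` et `e^π` sont transcendants … mais on ne sait rien de `π^e`, `π^π` ou `e^e`."

## What is proved here

* `eSeries_single`, `isStrictEFunction_single`, `mem_eValues_of_isAlgebraic`: the constant `β ∈ ℚ̄`
  (coefficient sequence `Pi.single 0 β`) is a strict `E`-function in the sense of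
  `IsStrictEFunction` (ODE `F′ = 0`; conjugates of `a₀ = β` bounded; denominators `Dₙ = d²` for an
  integer `d ≠ 0` with `dβ ∈ O_ℚ̄`), hence `ℚ̄ ⊆ eValues`.
* `transcendental_of_not_mem_eValues`: a complex number that is not an `E`-value is transcendental.
* `ExpExpNotEValue.transcendental_exp_exp` (and `.irrational_exp_exp`),
  `ExpAddPiNotEValue.transcendental_exp_add_pi`, `ExpMulPiNotEValue.transcendental_exp_mul_pi`,
  `PiPowExpNotEValue.transcendental_pi_pow_exp`: each conjectural exclusion implies the
  transcendence (a fortiori the irrationality) of `e^e`, `e + π`, `eπ`, `π^e` respectively — statements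
  printed as unknown (p. 204). So a discharge `theorem ExpExpNotEValue_holds` would settle an open
  problem; the four statements stay conjectural `def`s (CONVENTIONS §4), which is deliberately all
  this file says about them.
* `ExpMulPiNotEValue.expOneMulPiIrrational`, `ExpAddPiNotEValue.expOneAddPiIrrational`: the two
  exclusions imply the tree's named OPEN statements **periods.S15**
  `Literature.NumberTheory.Transcendental.ExpOneMulPiIrrational` (`eπ` irrational) and
  `Literature.NumberTheory.Transcendental.ExpOneAddPiIrrational` (`e + π` irrational) — "On ne
  sait pas montrer non plus que les nombres `e + π` et `eπ` sont irrationnels" (p. 204); what is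
  known unconditionally is only the disjunction
  `Literature.NumberTheory.Transcendental.transcendental_exp_one_add_pi_or_mul_pi_holds` ("au
  moins l'un des deux est transcendant car `e` et `π` le sont", p. 204).
* `expOneAddPiIrrational_of_expOnePiAlgebraicIndependent`, `expOneAddPiIrrational_of_schanuel`
  (and the `eπ` twins `expOneMulPiIrrational_of_expOnePiAlgebraicIndependent`,
  `expOneMulPiIrrational_of_schanuel`): the OPEN statements periods.S15 also sit below the tree's
  registered open conjecture `Literature.NumberTheory.Transcendental.ExpOnePiAlgebraicIndependent`
  (`e, π` algebraically independent) and below Schanuel's conjecture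
  (`∀ n, Literature.NumberTheory.Transcendental.SchanuelRank n`) — one-line compositions of
  `transcendental_add_of_algebraicIndependent` / `transcendental_mul_of_algebraicIndependent` /
  `transcendental_exp_add_pi_of_schanuel` / `transcendental_exp_mul_pi_of_schanuel`
  (`EFunctionValuesAtAlgebraicPoints.lean`, §5 p. 226 of the source) with Mathlib's
  `Transcendental.irrational`; PROVED reductions between open statements, not discharges.

* `ExpAddPiNotEValue.irrational_exp_add_pi`, `ExpMulPiNotEValue.irrational_exp_mul_pi`,
  `PiPowExpNotEValue.irrational_pi_pow_exp` (appended 2026-08-15, unit `provefact` for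
  `ExpAddPiNotEValue`): the IRRATIONALITY corollaries, i.e. the exact granularity at which the
  source prints the status of `e + π` and `eπ` as unknown — "On ne sait pas montrer non plus que
  les nombres `e + π` et `eπ` sont irrationnels" (§4 p. 204); their transcendence is listed among
  "plusieurs problèmes classiques encore ouverts, dont la transcendance de `e + π` et de `eπ`
  puisque `e, e⁻¹ ∈ 𝐄` et `π ∈ 𝐆`" (§8 Problème 10, p. 289), where `𝐄` is "l'ensemble de toutes
  les valeurs des `E`-fonctions au sens strict en des points algébriques" (§8 Problème 6, p. 286)
  — the set rendered by `eValues`. Hence no `ExpAddPiNotEValue_holds` either: it would settle the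
  irrationality of `e + π`.
  (Restored 2026-08-15 after an out-of-order whole-file apply, p20537, had dropped them.)
## References

* [Rivoal2024] T. Rivoal, *Les E-fonctions et G-fonctions de Siegel*, in: Périodes et
  transcendance, Journées mathématiques X-UPS 2019, Éditions de l'École polytechnique (2024),
  doi:10.5802/xups.2019-03: §4 p. 204, §5 p. 226, §5.1 p. 228 (examples after Définition 5.2).
  Also §8 Problème 6 (p. 286: the set `𝐄` of `E`-values) and Problème 10 (p. 289: transcendence of
  `e + π`, `eπ` open).
-/

noncomputable section

open Complex Polynomial
open scoped Nat

namespace Literature.Barriers.Schanuel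

/-! ### 1. Constants in `ℚ̄` are strict `E`-functions; `ℚ̄ ⊆ eValues` -/

/-- The `E`-series with coefficients `a = (β, 0, 0, …)` is the constant function `β`. [folklore] -/
theorem eSeries_single (β : ℂ) : eSeries (Pi.single 0 β) = fun _ => β := by
  funext z
  unfold eSeries
  rw [tsum_eq_single 0 fun n hn => by simp [Pi.single_eq_of_ne hn]]
  simp

/-- **Constants `β ∈ ℚ̄` are strict `E`-functions** ("Donnons quelques exemples de `E`-fonctions :
les polynômes de `ℚ̄[z]`, …"): with `a = (β, 0, 0, …)`, (i) `F′ = 0`; (ii) the conjugates of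
`a₀ = β` are finitely many, those of `aₙ = 0` are `0`; (iii) `Dₙ = d²` where `d ∈ ℤ ∖ {0}` makes
`dβ` an algebraic integer. PROVED from `IsStrictEFunction` (Définition 5.2).
[cite: Rivoal2024, §5.1 p. 228] -/
theorem isStrictEFunction_single {β : ℂ} (hβ : IsAlgebraic ℚ β) :
    IsStrictEFunction (Pi.single 0 β) := by
  refine ⟨fun n => ?_, ?_, ?_, ?_⟩
  · -- coefficients are algebraic
    rcases eq_or_ne n 0 with rfl | hn
    · simpa using hβ
    · simpa [Pi.single_eq_of_ne hn] using isAlgebraic_zero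
  · -- the ODE `0 · F + 1 · F′ = 0`
    refine ⟨1, ![0, 1], ?_, ?_, ?_⟩
    · intro h
      have := congr_fun h 1
      simp at this
    · intro j k
      fin_cases j
      · simpa using isAlgebraic_zero
      · simp only [Fin.mk_one, Fin.isValue, Matrix.cons_val_one, Matrix.cons_val_fin_one,
          Polynomial.coeff_one]
        split_ifs
        · exact isAlgebraic_one
        · exact isAlgebraic_zero
    · intro z
      rw [eSeries_single]
      simp [Fin.sum_univ_two]
  · -- (ii) conjugates bounded by `C^{n+1}`, `C = max 1 M`
    obtain ⟨M, hM⟩ : ∃ M : ℝ, ∀ b ∈ (minpoly ℚ β).rootSet ℂ, ‖b‖ ≤ M := by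
      obtain ⟨M, hM⟩ := ((Polynomial.rootSet_finite (minpoly ℚ β) ℂ).image fun b => ‖b‖).bddAbove
      exact ⟨M, fun b hb => hM (Set.mem_image_of_mem _ hb)⟩
    refine ⟨max 1 M, lt_max_of_lt_left one_pos, fun n b hb => ?_⟩
    rcases eq_or_ne n 0 with rfl | hn
    · simp only [Pi.single_eq_same, zero_add, pow_one] at hb ⊢
      exact (hM b hb).trans (le_max_right _ _)
    · rw [Pi.single_eq_of_ne hn, minpoly.zero, Polynomial.mem_rootSet] at hb
      obtain rfl : b = 0 := by simpa using hb.2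
      rw [norm_zero]
      positivity
  · -- (iii) denominators `Dₙ = d²`
    have hβℤ : IsAlgebraic ℤ β := (IsFractionRing.isAlgebraic_iff ℤ ℚ ℂ).mpr hβ
    obtain ⟨d, hd, hint⟩ := hβℤ.exists_integral_multiple
    rw [Algebra.smul_def, eq_intCast] at hint
    have hd1 : (1 : ℤ) ≤ d ^ 2 := (one_le_sq_iff_one_le_abs d).mpr (Int.one_le_abs hd)
    have hd1' : (1 : ℝ) ≤ ((d ^ 2 : ℤ) : ℝ) := by exact_mod_cast hd1
    refine ⟨fun _ => d ^ 2, ((d ^ 2 : ℤ) : ℝ), one_pos.trans_le hd1', fun n => ⟨hd1, ?_, ?_⟩⟩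
    · exact le_self_pow₀ hd1' (Nat.succ_ne_zero n)
    · intro m _
      rcases eq_or_ne m 0 with rfl | hm
      · have hdint : IsIntegral ℤ ((d : ℤ) : ℂ) := by
          simpa using isIntegral_algebraMap (R := ℤ) (A := ℂ) (x := d)
        have : ((d ^ 2 : ℤ) : ℂ) * (Pi.single 0 β : ℕ → ℂ) 0 = (d : ℂ) * ((d : ℂ) * β) := by
          rw [Pi.single_eq_same]; push_cast; ring
        rw [this]
        exact hdint.mul hint
      · simpa [Pi.single_eq_of_ne hm] using isIntegral_zero

/-- **Every algebraic number is an `E`-value**: `β = F(0)` for the constant strict `E`-function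
`F = β`. PROVED. [cite: Rivoal2024, §5.1 p. 228] -/
theorem mem_eValues_of_isAlgebraic {β : ℂ} (hβ : IsAlgebraic ℚ β) : β ∈ eValues :=
  ⟨Pi.single 0 β, 0, isStrictEFunction_single hβ, isAlgebraic_zero, by rw [eSeries_single]⟩

/-- Contrapositive: a complex number which is not an `E`-value is transcendental over `ℚ`.
PROVED. [cite: Rivoal2024, §5.1 p. 228] -/
theorem transcendental_of_not_mem_eValues {w : ℂ} (h : w ∉ eValues) : Transcendental ℚ w :=
  fun hw => h (mem_eValues_of_isAlgebraic hw)

/-! ### 2. What a discharge of the four conjectural exclusions would prove -/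

/-- **`ExpExpNotEValue` ⟹ `e^e` is transcendental** — while "on ne sait rien de `π^e`, `π^π` ou
`e^e`": a discharge `ExpExpNotEValue_holds` would settle an open problem, so the named statement
(printed as "on pense que …") stays conjectural. PROVED.
[cite: Rivoal2024, §4 p. 204 and §5 p. 226] -/
theorem ExpExpNotEValue.transcendental_exp_exp (h : ExpExpNotEValue) :
    Transcendental ℚ (Real.exp (Real.exp 1)) := by
  have h' : Transcendental ℚ (cexp (cexp 1)) := transcendental_of_not_mem_eValues h
  rw [show cexp (cexp 1) = ((Real.exp (Real.exp 1) : ℝ) : ℂ) by simp [Complex.ofReal_exp]] at h'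
  exact (transcendental_algebraMap_iff (A := ℂ) Complex.ofReal_injective).mp h'

/-- **`ExpExpNotEValue` ⟹ `e^e` is irrational** (not known: "on ne sait rien de … `e^e`").
PROVED. [cite: Rivoal2024, §4 p. 204] -/
theorem ExpExpNotEValue.irrational_exp_exp (h : ExpExpNotEValue) :
    Irrational (Real.exp (Real.exp 1)) :=
  h.transcendental_exp_exp.irrational

/-- **`ExpAddPiNotEValue` ⟹ `e + π` is transcendental** — while "On ne sait pas montrer non plus
que les nombres `e + π` et `eπ` sont irrationnels". PROVED.
[cite: Rivoal2024, §4 p. 204 and §5 p. 226] -/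
theorem ExpAddPiNotEValue.transcendental_exp_add_pi (h : ExpAddPiNotEValue) :
    Transcendental ℚ (Real.exp 1 + Real.pi) :=
  (transcendental_algebraMap_iff (A := ℂ) Complex.ofReal_injective).mp
    (transcendental_of_not_mem_eValues h)

/-- **`ExpMulPiNotEValue` ⟹ `eπ` is transcendental** (irrationality of `eπ` is not known).
PROVED. [cite: Rivoal2024, §4 p. 204 and §5 p. 226] -/
theorem ExpMulPiNotEValue.transcendental_exp_mul_pi (h : ExpMulPiNotEValue) :
    Transcendental ℚ (Real.exp 1 * Real.pi) :=
  (transcendental_algebraMap_iff (A := ℂ) Complex.ofReal_injective).mp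
    (transcendental_of_not_mem_eValues h)

/-- **`PiPowExpNotEValue` ⟹ `π^e` is transcendental** — while "on ne sait rien de `π^e`".
PROVED. [cite: Rivoal2024, §4 p. 204 and §5 p. 226] -/
theorem PiPowExpNotEValue.transcendental_pi_pow_exp (h : PiPowExpNotEValue) :
    Transcendental ℚ (Real.pi ^ Real.exp 1) :=
  (transcendental_algebraMap_iff (A := ℂ) Complex.ofReal_injective).mp
    (transcendental_of_not_mem_eValues h)

/-! ### 3. The exclusions of `eπ` and `e + π` sit above the named open problems periods.S15 -/

/-- **`ExpMulPiNotEValue` ⟹ `ExpOneMulPiIrrational`** (periods.S15: `eπ` is irrational) — the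
tree's named OPEN statement: "On ne sait pas montrer non plus que les nombres `e + π` et `eπ`
sont irrationnels" (only the disjunction `transcendental_exp_one_add_pi_or_mul_pi_holds` is
known). So a discharge `ExpMulPiNotEValue_holds` would settle periods.S15. PROVED reduction.
[cite: Rivoal2024, §4 p. 204 and §5 p. 226] -/
theorem ExpMulPiNotEValue.expOneMulPiIrrational (h : ExpMulPiNotEValue) :
    Literature.NumberTheory.Transcendental.ExpOneMulPiIrrational :=
  h.transcendental_exp_mul_pi.irrational

/-- **`ExpAddPiNotEValue` ⟹ `ExpOneAddPiIrrational`** (periods.S15: `e + π` is irrational, OPEN,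
same sentence of the source). PROVED reduction. [cite: Rivoal2024, §4 p. 204 and §5 p. 226] -/
theorem ExpAddPiNotEValue.expOneAddPiIrrational (h : ExpAddPiNotEValue) :
    Literature.NumberTheory.Transcendental.ExpOneAddPiIrrational :=
  h.transcendental_exp_add_pi.irrational

/-! ### 4. … and below the algebraic independence of `e` and `π`, hence below Schanuel -/

/-- **`ExpOnePiAlgebraicIndependent` ⟹ `ExpOneAddPiIrrational`** (periods.S15): if `e` and `π`
are algebraically independent over `ℚ` — the tree's registered OPEN conjecture, the flagship
consequence of Schanuel's conjecture — then `e + π` is transcendental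
(`transcendental_add_of_algebraicIndependent`), in particular irrational. PROVED reduction
between two open statements ("On ne sait pas montrer non plus que les nombres `e + π` et `eπ`
sont irrationnels"). [cite: Rivoal2024, §4 p. 204 and §5 p. 226] -/
theorem expOneAddPiIrrational_of_expOnePiAlgebraicIndependent
    (h : Literature.NumberTheory.Transcendental.ExpOnePiAlgebraicIndependent) :
    Literature.NumberTheory.Transcendental.ExpOneAddPiIrrational :=
  (transcendental_add_of_algebraicIndependent h).irrational

/-- **`ExpOnePiAlgebraicIndependent` ⟹ `ExpOneMulPiIrrational`** (periods.S15): likewise `eπ`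
is transcendental (`transcendental_mul_of_algebraicIndependent`), in particular irrational.
PROVED reduction between two open statements. [cite: Rivoal2024, §4 p. 204 and §5 p. 226] -/
theorem expOneMulPiIrrational_of_expOnePiAlgebraicIndependent
    (h : Literature.NumberTheory.Transcendental.ExpOnePiAlgebraicIndependent) :
    Literature.NumberTheory.Transcendental.ExpOneMulPiIrrational :=
  (transcendental_mul_of_algebraicIndependent h).irrational

/-- **Schanuel ⟹ `ExpOneAddPiIrrational`** (periods.S15): under Schanuel's conjecture `e + π` is
transcendental (`transcendental_exp_add_pi_of_schanuel`), in particular irrational. PROVED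
conditional. [cite: Rivoal2024, §5 p. 226] -/
theorem expOneAddPiIrrational_of_schanuel
    (hSC : ∀ n, Literature.NumberTheory.Transcendental.SchanuelRank n) :
    Literature.NumberTheory.Transcendental.ExpOneAddPiIrrational :=
  (transcendental_exp_add_pi_of_schanuel hSC).irrational

/-- **Schanuel ⟹ `ExpOneMulPiIrrational`** (periods.S15): under Schanuel's conjecture `eπ` is
transcendental (`transcendental_exp_mul_pi_of_schanuel`), in particular irrational. PROVED
conditional. [cite: Rivoal2024, §5 p. 226] -/
theorem expOneMulPiIrrational_of_schanuel
    (hSC : ∀ n, Literature.NumberTheory.Transcendental.SchanuelRank n) :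
    Literature.NumberTheory.Transcendental.ExpOneMulPiIrrational :=
  (transcendental_exp_mul_pi_of_schanuel hSC).irrational

/-! ### 5. The irrationality corollaries (the printed open statements for `e + π`, `eπ`, `π^e`) -/

/-- **`ExpAddPiNotEValue` ⟹ `e + π` is irrational** — the statement the source prints as unknown:
"On ne sait pas montrer non plus que les nombres `e + π` et `eπ` sont irrationnels"; a discharge
`ExpAddPiNotEValue_holds` would therefore settle an open problem (its transcendence is listed
among the "problèmes classiques encore ouverts", §8 Problème 10, p. 289). PROVED.
[cite: Rivoal2024, §4 p. 204] -/
theorem ExpAddPiNotEValue.irrational_exp_add_pi (h : ExpAddPiNotEValue) :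
    Irrational (Real.exp 1 + Real.pi) :=
  h.transcendental_exp_add_pi.irrational

/-- **`ExpMulPiNotEValue` ⟹ `eπ` is irrational** (printed as unknown, same sentence). PROVED.
[cite: Rivoal2024, §4 p. 204] -/
theorem ExpMulPiNotEValue.irrational_exp_mul_pi (h : ExpMulPiNotEValue) :
    Irrational (Real.exp 1 * Real.pi) :=
  h.transcendental_exp_mul_pi.irrational

/-- **`PiPowExpNotEValue` ⟹ `π^e` is irrational** ("on ne sait rien de `π^e`"). PROVED.
[cite: Rivoal2024, §4 p. 204] -/
theorem PiPowExpNotEValue.irrational_pi_pow_exp (h : PiPowExpNotEValue) :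
    Irrational (Real.pi ^ Real.exp 1) :=
  h.transcendental_pi_pow_exp.irrational

end Literature.Barriers.Schanuel

end
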